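import Literature.Analysis.FluidPDE.FiniteFourierModeEulerPlanarCoord
import Literature.Analysis.FluidPDE.FiniteFourierModeEulerSIP

/-!
# Kishimoto–Yoneda §3 (planar case): the horizontal component is itself a solution

Support file for `FiniteFourierModeEuler` (N. Kishimoto, T. Yoneda, J. Math. Fluid Mech. 24
(2022) 74 = arXiv:2110.08039), §3: "Take the horizontal component of the equation (cond:Euler)
… Namely, the horizontal component `u^∥(t,x)` is in itself a solution of (cond:Euler)." For a
finite-mode solution with planar support `S ⊂ e^⊥` whose horizontal parts are, mode by mode,
either identically zero or never zero on `I` (a generic interval), the horizontal parts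
`horiz e (u_n)`, `n ∈ S_h`, form a finite-mode Euler solution with support `S_h`
(`IsFiniteModeEulerSolution.planarHoriz`).

## References

* [KishimotoYoneda2022] N. Kishimoto, T. Yoneda, J. Math. Fluid Mech. 24 (2022) 74 =
  arXiv:2110.08039, §3 proof of Prop. 3.1 (i), (cond:parallel).
-/

noncomputable section

open Matrix Finset Complex

namespace Literature.Analysis.FluidPDE

namespace KY

open scoped Classical

/-- The planar setting on a generic interval: a finite-mode solution with support in the plane
`e^⊥`, and the set `S_h ⊆ S` of modes with non-vanishing horizontal part (never zero on `I`),
the others having identically vanishing horizontal part. [cite: KishimotoYoneda2022, §3 (`S_∥`)] -/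
structure PlanarCfg (I : Set ℝ) (S : Finset (Fin 3 → ℝ)) (u : (Fin 3 → ℝ) → ℝ → (Fin 3 → ℂ))
    (e : Fin 3 → ℝ) (S_h : Finset (Fin 3 → ℝ)) : Prop where
  sol : IsFiniteModeEulerSolution I S u
  he : e ≠ 0
  plane : ∀ n ∈ S, e ⬝ᵥ n = 0
  sub : S_h ⊆ S
  hon : ∀ n ∈ S_h, ∀ t ∈ I, hcoef e n (u n t) ≠ 0
  hoff : ∀ n ∈ S, n ∉ S_h → ∀ t ∈ I, hcoef e n (u n t) = 0

/-- The horizontal component `u^∥` as a coefficient family with support `S_h`.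
[cite: KishimotoYoneda2022, §3 (`u^∥ ∈ ℋ_I`)] -/
def uh (e : Fin 3 → ℝ) (S_h : Finset (Fin 3 → ℝ)) (u : (Fin 3 → ℝ) → ℝ → (Fin 3 → ℂ))
    (n : Fin 3 → ℝ) (t : ℝ) : Fin 3 → ℂ :=
  if n ∈ S_h then horiz e (u n t) else 0

namespace PlanarCfg

variable {I : Set ℝ} {S : Finset (Fin 3 → ℝ)} {u : (Fin 3 → ℝ) → ℝ → (Fin 3 → ℂ)}
  {e : Fin 3 → ℝ} {S_h : Finset (Fin 3 → ℝ)} (P : PlanarCfg I S u e S_h)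
include P

/-- The decomposition of every occupied mode on `I`. [cite: KishimotoYoneda2022, §3] -/
theorem decomp_mem {n : Fin 3 → ℝ} (hn : n ∈ S) {t : ℝ} (ht : t ∈ I) :
    u n t = hcoef e n (u n t) • cplx (e ⨯₃ n) + vert e (u n t) • cplx e :=
  decomp P.he (P.sol.ne_zero_of_mem hn) (P.plane n hn) (P.sol.div_free n hn t ht)

/-- The horizontal part of an occupied mode is `α_n (e × n)`. [cite: KishimotoYoneda2022, §3] -/
theorem horiz_mem {n : Fin 3 → ℝ} (hn : n ∈ S) {t : ℝ} (ht : t ∈ I) :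
    horiz e (u n t) = hcoef e n (u n t) • cplx (e ⨯₃ n) :=
  horiz_eq P.he (P.sol.ne_zero_of_mem hn) (P.plane n hn) (P.sol.div_free n hn t ht)

/-- `u^∥_n = horiz (u_n)` for every frequency, on `I`. [cite: KishimotoYoneda2022, §3] -/
theorem uh_eq_horiz (n : Fin 3 → ℝ) {t : ℝ} (ht : t ∈ I) : uh e S_h u n t = horiz e (u n t) := by
  unfold uh
  split_ifs with h
  · rfl
  · by_cases hnS : n ∈ S
    · rw [P.horiz_mem hnS ht, P.hoff n hnS h t ht, zero_smul]
    · rw [P.sol.eq_zero_of_notMem n hnS t, horiz_zero]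

omit P in
/-- `u^∥_n = horiz u_n` on `S_h`. [cite: KishimotoYoneda2022, §3] -/
theorem uh_of_mem {n : Fin 3 → ℝ} (hn : n ∈ S_h) (t : ℝ) : uh e S_h u n t = horiz e (u n t) := by
  unfold uh; rw [if_pos hn]

omit P in
/-- `u^∥_n = 0` off `S_h`. [cite: KishimotoYoneda2022, §3] -/
theorem uh_of_notMem {n : Fin 3 → ℝ} (hn : n ∉ S_h) (t : ℝ) : uh e S_h u n t = 0 := by
  unfold uh; rw [if_neg hn]

/-- `S_h` is symmetric. [cite: KishimotoYoneda2022, §3] -/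
theorem neg_mem_h {n : Fin 3 → ℝ} (hn : n ∈ S_h) : -n ∈ S_h := by
  have hnS : n ∈ S := P.sub hn
  have hnegS : -n ∈ S := P.sol.neg_mem n hnS
  by_contra hneg
  obtain ⟨t, ht⟩ := P.sol.nonempty
  have h0 := P.hoff (-n) hnegS hneg t ht
  have h1 := P.hon n hn t ht
  apply h1
  -- `hcoef e (-n) (star z) = -star (hcoef e n z)` up to the real denominator
  rw [P.sol.conj n t] at h0
  unfold hcoef at h0 ⊢
  rw [map_neg, cplx_neg] at h0
  have hden : dot (-cplx (e ⨯₃ n)) (-cplx (e ⨯₃ n)) = dot (cplx (e ⨯₃ n)) (cplx (e ⨯₃ n)) := by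
    simp [dot_eq]
  rw [hden] at h0
  have hk : dot (cplx (e ⨯₃ n)) (cplx (e ⨯₃ n)) ≠ 0 :=
    dot_cplx_self_ne_zero (cross_normal_ne_zero P.he (P.sol.ne_zero_of_mem hnS) (P.plane n hnS))
  rcases div_eq_zero_iff.1 h0 with h0 | h0
  · have h3 : dot (cplx (e ⨯₃ n)) (star (u n t)) = 0 := by
      have : dot (-cplx (e ⨯₃ n)) (star (u n t)) = -dot (cplx (e ⨯₃ n)) (star (u n t)) := by
        simp [dot_eq]; ring
      rw [this, neg_eq_zero] at h0; exact h0
    have h2 : star (dot (cplx (e ⨯₃ n)) (u n t)) = 0 := by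
      rw [← h3]; simp [dot_eq, cplx_apply]
    rw [star_eq_zero] at h2
    rw [h2, zero_div]
  · exact absurd h0 hk

/-- The horizontal family is supported in the plane. [folklore] -/
theorem plane_h {n : Fin 3 → ℝ} (hn : n ∈ S_h) : e ⬝ᵥ n = 0 := P.plane n (P.sub hn)

/-! ### Differentiability and the derivative of the horizontal part -/

/-- Coordinates of occupied modes are differentiable at interior times. [folklore] -/
theorem differentiableAt_coord (n : Fin 3 → ℝ) (i : Fin 3) {t : ℝ} (ht : t ∈ I) :
    DifferentiableAt ℝ (fun s => u n s i) t :=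
  (P.sol.differentiableOn n i).differentiableAt (P.sol.isOpen.mem_nhds ht)

omit P in
/-- The horizontal part, coordinatewise, as an explicit combination of coordinates. [folklore] -/
theorem horiz_apply (z : Fin 3 → ℂ) (i : Fin 3) :
    horiz e z i = z i - (∑ j, (e j : ℂ) * z j) / dot (cplx e) (cplx e) * (e i : ℂ) := by
  show (z - (dot (cplx e) z / dot (cplx e) (cplx e)) • cplx e) i = _
  rw [Pi.sub_apply, Pi.smul_apply, smul_eq_mul, cplx_apply]
  rfl

/-- The horizontal part of a mode is differentiable on `I`. [folklore] -/
theorem differentiableOn_horiz (n : Fin 3 → ℝ) (i : Fin 3) :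
    DifferentiableOn ℝ (fun s => horiz e (u n s) i) I := by
  have h : (fun s => horiz e (u n s) i)
      = fun s => u n s i - (∑ j, (e j : ℂ) * u n s j) / dot (cplx e) (cplx e) * (e i : ℂ) := by
    funext s; rw [horiz_apply]
  rw [h]
  apply DifferentiableOn.sub (P.sol.differentiableOn n i)
  apply DifferentiableOn.mul_const
  apply DifferentiableOn.div_const
  exact DifferentiableOn.fun_sum fun j _ => (P.sol.differentiableOn n j).const_mul _

/-- **The derivative of the horizontal part is the horizontal part of the derivative.** [folklore] -/
theorem deriv_horiz (n : Fin 3 → ℝ) {t : ℝ} (ht : t ∈ I) (i : Fin 3) :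
    deriv (fun s => horiz e (u n s) i) t = horiz e (fun j => deriv (fun s => u n s j) t) i := by
  have h : (fun s => horiz e (u n s) i)
      = fun s => u n s i - (∑ j, (e j : ℂ) * u n s j) / dot (cplx e) (cplx e) * (e i : ℂ) := by
    funext s; rw [horiz_apply]
  rw [h, horiz_apply]
  have hd : ∀ j, DifferentiableAt ℝ (fun s => u n s j) t := fun j => P.differentiableAt_coord n j ht
  have hsum : DifferentiableAt ℝ (fun s => ∑ j, (e j : ℂ) * u n s j) t :=
    DifferentiableAt.fun_sum fun j _ => (hd j).const_mul _
  rw [deriv_fun_sub (hd i) ((hsum.div_const _).mul_const _), deriv_mul_const (hsum.div_const _),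
    deriv_div_const, deriv_fun_sum fun j _ => (hd j).const_mul _]
  congr 3
  refine Finset.sum_congr rfl fun j _ => ?_
  rw [deriv_const_mul _ (hd j)]

/-- The derivative vector of an occupied mode is minus the nonlinearity. [cite: KishimotoYoneda2022, §1 (1.3)] -/
theorem deriv_vec_eq {n : Fin 3 → ℝ} (hn : n ≠ 0) {t : ℝ} (ht : t ∈ I) :
    (fun j => deriv (fun s => u n s j) t) = -nonlin S (fun m => u m t) n := by
  funext j; rw [P.sol.deriv_eq hn ht j]; rfl

/-! ### The horizontal component of the nonlinearity -/

/-- Pairs of occupied frequencies summing to a non-planar frequency do not exist. [folklore] -/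
theorem filter_pairs_eq_empty {n : Fin 3 → ℝ} (hn : e ⬝ᵥ n ≠ 0) {T : Finset (Fin 3 → ℝ)} (hT : T ⊆ S) :
    (T ×ˢ T).filter (fun q : (Fin 3 → ℝ) × (Fin 3 → ℝ) => q.1 + q.2 = n) = ∅ := by
  rw [Finset.filter_eq_empty_iff]
  rintro ⟨a, b⟩ hq hab
  rw [Finset.mem_product] at hq
  apply hn
  rw [← hab, dotProduct_add, P.plane a (hT hq.1), P.plane b (hT hq.2), add_zero]

/-- **The horizontal component of the nonlinearity of `u` is the nonlinearity of `u^∥`.**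
[cite: KishimotoYoneda2022, §3 (cond:parallel)] -/
theorem horiz_nonlin (n : Fin 3 → ℝ) {t : ℝ} (ht : t ∈ I) :
    horiz e (nonlin S (fun m => u m t) n) = nonlin S_h (fun m => uh e S_h u m t) n := by
  by_cases hn : e ⬝ᵥ n = 0
  · rw [nonlin_eq_sum_bracket, nonlin_eq_sum_bracket, horiz_smul, horiz_proj hn, horiz_sum]
    congr 2
    -- bracket by bracket
    have hb : ∀ q ∈ (S ×ˢ S).filter (fun q : (Fin 3 → ℝ) × (Fin 3 → ℝ) => q.1 + q.2 = n),
        horiz e (bracket q.1 q.2 (u q.1 t) (u q.2 t))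
          = bracket q.1 q.2 (uh e S_h u q.1 t) (uh e S_h u q.2 t) := by
      rintro ⟨a, b⟩ hq
      simp only [Finset.mem_filter, Finset.mem_product] at hq
      obtain ⟨⟨ha, hb⟩, -⟩ := hq
      rw [horiz_bracket_planar P.he (P.plane a ha) (P.plane b hb) (P.decomp_mem ha ht) (P.decomp_mem hb ht),
        P.uh_eq_horiz a ht, P.uh_eq_horiz b ht, P.horiz_mem ha ht, P.horiz_mem hb ht]
    rw [Finset.sum_congr rfl hb]
    -- restrict the index set to `S_h × S_h`
    symm
    apply Finset.sum_subset
    · intro q hq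
      simp only [Finset.mem_filter, Finset.mem_product] at hq ⊢
      exact ⟨⟨P.sub hq.1.1, P.sub hq.1.2⟩, hq.2⟩
    · rintro ⟨a, b⟩ hq' hq
      simp only [Finset.mem_filter, Finset.mem_product, not_and] at hq hq'
      by_cases ha : a ∈ S_h
      · by_cases hb' : b ∈ S_h
        · exact absurd hq'.2 (hq ⟨ha, hb'⟩)
        · rw [uh_of_notMem hb', bracket_zero_right]
      · rw [uh_of_notMem ha, bracket_zero_left]
  · rw [nonlin_eq_sum_bracket, nonlin_eq_sum_bracket, P.filter_pairs_eq_empty hn subset_rfl,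
      P.filter_pairs_eq_empty hn P.sub, Finset.sum_empty, Finset.sum_empty, proj_zero, smul_zero,
      horiz_zero]

/-! ### The horizontal solution -/

/-- **The horizontal component `u^∥` is in itself a finite-mode Euler solution** with support
`S_h` on `I`. [cite: KishimotoYoneda2022, §3 proof of Prop. 3.1 (i) ((cond:parallel))] -/
theorem planarHoriz : IsFiniteModeEulerSolution I S_h (uh e S_h u) where
  isOpen := P.sol.isOpen
  ordConnected := P.sol.ordConnected
  nonempty := P.sol.nonempty
  zero_notMem := fun h => P.sol.zero_notMem (P.sub h)
  neg_mem := fun n hn => P.neg_mem_h hn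
  eq_zero_of_notMem := fun n hn t => uh_of_notMem hn t
  exists_ne_zero := by
    intro n hn
    obtain ⟨t, ht⟩ := P.sol.nonempty
    refine ⟨t, ht, ?_⟩
    rw [uh_of_mem hn, P.horiz_mem (P.sub hn) ht]
    exact smul_ne_zero (P.hon n hn t ht) ((cplx_eq_zero_iff _).not.2
      (cross_normal_ne_zero P.he (P.sol.ne_zero_of_mem (P.sub hn)) (P.plane_h hn)))
  conj := by
    intro n t
    by_cases hn : n ∈ S_h
    · rw [uh_of_mem hn, uh_of_mem (P.neg_mem_h hn), P.sol.conj n t, horiz_star]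
    · have hneg : -n ∉ S_h := fun h => hn (by simpa using P.neg_mem_h h)
      rw [uh_of_notMem hn, uh_of_notMem hneg, star_zero]
  div_free := by
    intro n hn t ht
    rw [uh_of_mem hn]
    unfold horiz
    rw [dot_sub_right, dot_smul_right, P.sol.div_free n (P.sub hn) t ht, dot_cplx_n_e (P.plane_h hn),
      mul_zero, sub_zero]
  differentiableOn := by
    intro n i
    by_cases hn : n ∈ S_h
    · have : (fun t => uh e S_h u n t i) = fun t => horiz e (u n t) i := by
        funext t; rw [uh_of_mem hn]
      rw [this]; exact P.differentiableOn_horiz n i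
    · have : (fun t => uh e S_h u n t i) = fun _ => 0 := by
        funext t; rw [uh_of_notMem hn]; rfl
      rw [this]; exact differentiableOn_const 0
  euler := by
    intro n hn0 t ht i
    rw [← P.horiz_nonlin n ht]
    by_cases hn : n ∈ S_h
    · have : (fun s => uh e S_h u n s i) = fun s => horiz e (u n s) i := by
        funext s; rw [uh_of_mem hn]
      rw [this, P.deriv_horiz n ht i, P.deriv_vec_eq hn0 ht, horiz_neg]
      simp
    · have h0 : (fun s => uh e S_h u n s i) = fun _ => 0 := by
        funext s; rw [uh_of_notMem hn]; rfl
      rw [h0, deriv_const, zero_add]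
      by_cases hnS : n ∈ S
      · -- `horiz (u n ·) ≡ 0` on `I`, so the horizontal part of the derivative vanishes
        rw [← neg_eq_zero, ← Pi.neg_apply, ← horiz_neg, ← P.deriv_vec_eq hn0 ht, ← P.deriv_horiz n ht i]
        have hev : (fun s => horiz e (u n s) i) =ᶠ[nhds t] fun _ => 0 := by
          filter_upwards [P.sol.isOpen.mem_nhds ht] with s hs
          rw [P.horiz_mem hnS hs, P.hoff n hnS hn s hs, zero_smul]; rfl
        rw [hev.deriv_eq, deriv_const]
      · rw [P.sol.nonlin_eq_zero_of_notMem hnS hn0 ht, horiz_zero]; rfl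

end PlanarCfg

end KY

end Literature.Analysis.FluidPDE
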